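import Summits.BirchSwinnertonDyer.BirchSwinnertonDyer.Theses.SemiOrdinaryEisensteinDescent
import Summits.BirchSwinnertonDyer.BirchSwinnertonDyer.Theorems.SemiOrdinaryEisensteinDescentWildSplitEisensteinInclusionAtThreeStubSaturate
import Summits.BirchSwinnertonDyer.BirchSwinnertonDyer.Theorems.SemiOrdinaryEisensteinDescentWildSplitEisensteinInclusionAtThreeMuHalfOfPrint
import Summits.BirchSwinnertonDyer.BirchSwinnertonDyer.Theorems.UniversalToricDescentToricTransportModThreeNormProfile
import Literature.NumberTheory.EllipticCurves.IwasawaAlgebra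
import Literature.NumberTheory.EllipticCurves.IwasawaAlgebraPseudoNullProofs
import Literature.NumberTheory.EllipticCurves.IwasawaAlgebraRankOneIdealProofs
import Mathlib.RingTheory.Localization.Away.Basic
import HarnessLib

/-!
# Crux E `WildSplitEisensteinInclusionAtThree` (stmt-BirchSwinnertonDyer-20479), line `birth`: the LEVER in
# print's RATIONAL currency, the lever ⟺ the crux modulo Hsieh Thm. B, and the λ-DOMINANCE form of the crux
# — HELPER (`--supports 20479`), width seat bsd-wall-soed-p1-w2 g0

Route `SemiOrdinaryEisensteinDescent` (SOED), cell `pub/bsd-wall`. Registered skeleton v2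
(`Cruxes/WildSplitEisensteinInclusionAtThree/Lines/birth.lean`, lead bsd-wall-soed-p1 g0): crux E ⟸
`stub_semiOrdinaryTransferUpToPPower` (THE LEVER: `∃ k, 3^k·Ch_Λ(X_(∅,0))·R₀⟦T⟧ ⊆ (L)`) +
`stub_hsiehThmBAnyLevel` (Hsieh 2014 Thm. B by name) + `stub_saturate` (landed, p545527); the lead's verdict on
the lever is `promote-stub` (no Eisenstein engine in print at a supercuspidal `π₃`). THIS FILE adds, with NO new
definition, NO named fact and NO `sorry`, three pieces of glue that every future engine / re-lining of E uses:

* §1 **The lever in print's rational currency.** For an ideal `I` of `R₀⟦T⟧` and `L ∈ R₀⟦T⟧`: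
  `(∃ k, 3^k·I ⊆ (L))` ⟹ `I·R₀⟦T⟧[1/3] ⊆ (L)·R₀⟦T⟧[1/3]` (`map_away_le_of_exists_pow_mul_mem`), and conversely
  the rational inclusion gives back `3^k·x ∈ (L)` for every `x ∈ I` (`exists_pow_mul_mem_of_map_away_le`), with
  ONE `k` for all of `I` as soon as `I` is principal (`lever_span_iff_map_away_le`; also `= ∃ k, L ∣ 3^k·g`,
  `lever_span_iff_exists_dvd`). The crux's ideal `Ch_Λ(X_(∅,0))·R₀⟦T⟧` IS principal — `Ch_Λ` is principal in
  `Λ = ℤ₃⟦T⟧` (Literature `charIdeal_isPrincipal_holds`: `Λ` is a UFD) and the extension of a principal ideal is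
  principal (`charIdeal_map_eq_span`) — so the registered LEVER is LITERALLY the Eisenstein inclusion of the
  `(∅,0)` main conjecture in `Λ_{R₀}[1/3]` (`lever_conclusion_iff_rational`): the currency in which
  Eisenstein-congruence engines state their output (Skinner–Urban 2014 Thm. 3.29 «in `Λ ⊗ ℚ_p`»; Wan,
  arXiv:1412.1767 Thm. 1.1 before its `μ`-step).
* §2 **LEVER ⟺ crux E modulo Hsieh.** Pointwise, when `L` has a unit coefficient the lever's conclusion and the
  crux's conclusion are EQUIVALENT (`lever_conclusion_iff_le_of_exists_isUnit_coeff`: `stub_saturate` one way,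
  `k = 0` the other); globally `crux ⟹ LEVER` unconditionally (`lever_of_crux`) and, behind the named fact `hB` of
  p567302 §1, `lever_iff_crux_of_thmB : hB → (LEVER ↔ WildSplitEisensteinInclusionAtThree)`. Planning content:
  the lever-child of the proposed split «E = lever + Hsieh-by-name + glue» is NOT smaller than E — the split
  separates the `μ`-information and nothing else; a proof of the lever is a proof of E's whole `λ`-content.
* §3 **The λ-dominance form of E (third decomposition).** By the route-free norm-profile lemma of utd-p1 g2
  (`UniversalToricDescentNormProfile.eq_span_of_span_le_of_normProfile`, p531417): at an instance where the
  KOLYVAGIN-direction inclusion `(L) ⊆ Ch·R₀⟦T⟧` holds (the conclusion of route UTD's crux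
  `AdditiveSplitIMCInclusionAtThree`, stmt-BirchSwinnertonDyer-20395, displayed here as a hypothesis — that
  route is NOT imported) and `Ch·R₀⟦T⟧ = (g)` with `‖g_i‖ < 1 (i < n)` and `‖L_n‖ = 1` («`λ_alg ≥ n ≥ λ_an`,
  `μ_an = 0`»), the crux's inclusion holds, indeed with equality (`crux_conclusion_of_span_le_of_normProfile`);
  globally `WildSplitEisensteinInclusionAtThree_of_kolyvaginInclusion_of_dominance`. So
  E = [UTD 20395] + [λ-dominance], Hsieh's `μ = 0` being folded into `‖L_n‖ = 1`; and E + [UTD 20395] is the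
  EQUALITY `Ch·R₀⟦T⟧ = (L)` (`eq_span_iff_crux_and_kolyvagin`). CAVEAT (why this is not «E by name from UTD's
  cone»): UTD's `InvariantsTransportModThree` (20399) supplies the dominance datum only through a semistable
  twin `E′` whose conductor is Heegner for the SAME `K`; crux E quantifies over every `K` Heegner for `N(E)` alone.

HONEST STATUS: crux E is NOT closed and nothing here is progress on the lever's ENGINE; BSD is not proved for any
curve by any of this. Supports, does not close, stmt-BirchSwinnertonDyer-20479.

References: [SkinnerUrban2014] Thm. 3.29; [Wan2015Eisenstein] = arXiv:1412.1767 Thm. 1.1; [GreenbergVatsal2000]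
§1; [Washington1997] §7.1, §13.2; [Castella2018] §3 (the receptacle `R₀⟦T⟧`).
-/

set_option autoImplicit false
set_option linter.dupNamespace false -- `Summit.BirchSwinnertonDyer.BirchSwinnertonDyer.Theorems.…` (summit = sub)

noncomputable section

open scoped Classical

namespace Summit.BirchSwinnertonDyer.BirchSwinnertonDyer.Theorems.WildSplitEisensteinInclusionAtThreeLeverCurrency

open PowerSeries NumberField IsDedekindDomain Field
  Literature.NumberTheory.EllipticCurves
  Summit.BirchSwinnertonDyer.Rank1Residual.X11b
  Summit.BirchSwinnertonDyer.BirchSwinnertonDyer.Theses.SemiOrdinaryEisensteinDescent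
  Summit.BirchSwinnertonDyer.BirchSwinnertonDyer.Theorems
  Summit.BirchSwinnertonDyer.BirchSwinnertonDyer.Theorems.WildSplitEisensteinInclusionAtThreeSaturate

/-! ### §1 The lever in print's rational currency `R₀⟦T⟧[1/3]` -/

/-- `3 ≠ 0` in `R₀⟦T⟧` (its constant term is the prime `3` of `R₀`). [folklore] -/
theorem three_ne_zero : (3 : UnrSeries 3) ≠ 0 := by
  intro h
  have h0 := congrArg PowerSeries.constantCoeff h
  rw [map_ofNat, map_zero] at h0
  exact prime_three_unrIntegers.ne_zero h0

section Rational

variable {S : Type*} [CommRing S] [Algebra (UnrSeries 3) S] [IsLocalization.Away (3 : UnrSeries 3) S]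

/-- The structure map `R₀⟦T⟧ → R₀⟦T⟧[1/3]` is injective (`R₀⟦T⟧` is a domain, `3 ≠ 0`). [folklore] -/
theorem algebraMap_away_injective : Function.Injective (algebraMap (UnrSeries 3) S) :=
  IsLocalization.injective S (powers_le_nonZeroDivisors_of_noZeroDivisors three_ne_zero)

/-- **Integral-up-to-`3^k` ⟹ rational.** If `3^k·I ⊆ (L)` in `R₀⟦T⟧` then `I·R₀⟦T⟧[1/3] ⊆ (L)·R₀⟦T⟧[1/3]`
(in any localization `S` of `R₀⟦T⟧` away from `3`): `3` is a unit of `S`. [folklore] -/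
theorem map_away_le_of_exists_pow_mul_mem (I : Ideal (UnrSeries 3)) (L : UnrSeries 3)
    (h : ∃ k : ℕ, ∀ x ∈ I, (3 : UnrSeries 3) ^ k * x ∈ Ideal.span {L}) :
    I.map (algebraMap (UnrSeries 3) S) ≤ Ideal.span {algebraMap (UnrSeries 3) S L} := by
  obtain ⟨k, hk⟩ := h
  rw [Ideal.map_le_iff_le_comap]
  intro x hx
  rw [Ideal.mem_comap, Ideal.mem_span_singleton']
  obtain ⟨y, hy⟩ := Ideal.mem_span_singleton'.mp (hk x hx)
  -- `3^k` is a unit of `S`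
  obtain ⟨u, hu⟩ :=
    IsLocalization.map_units S (⟨(3 : UnrSeries 3) ^ k, k, rfl⟩ : Submonoid.powers (3 : UnrSeries 3))
  refine ⟨algebraMap (UnrSeries 3) S y * ↑u⁻¹, ?_⟩
  have h1 : algebraMap (UnrSeries 3) S y * algebraMap (UnrSeries 3) S L =
      (u : S) * algebraMap (UnrSeries 3) S x := by
    rw [← map_mul, hy, map_mul, hu]
  calc algebraMap (UnrSeries 3) S y * ↑u⁻¹ * algebraMap (UnrSeries 3) S L
      = ↑u⁻¹ * (algebraMap (UnrSeries 3) S y * algebraMap (UnrSeries 3) S L) := by ring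
    _ = ↑u⁻¹ * ((u : S) * algebraMap (UnrSeries 3) S x) := by rw [h1]
    _ = algebraMap (UnrSeries 3) S x := by rw [← mul_assoc, Units.inv_mul, one_mul]

/-- **Rational ⟹ integral-up-to-`3^k`, element form.** If `I·R₀⟦T⟧[1/3] ⊆ (L)·R₀⟦T⟧[1/3]` then every `x ∈ I`
satisfies `3^k·x ∈ (L)` for some `k` (depending on `x`): write the rational multiplier as `y/3^m` and clear
the denominator in the domain `R₀⟦T⟧`. [folklore] -/
theorem exists_pow_mul_mem_of_map_away_le (I : Ideal (UnrSeries 3)) (L : UnrSeries 3)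
    (h : I.map (algebraMap (UnrSeries 3) S) ≤ Ideal.span {algebraMap (UnrSeries 3) S L})
    (x : UnrSeries 3) (hx : x ∈ I) :
    ∃ k : ℕ, (3 : UnrSeries 3) ^ k * x ∈ Ideal.span {L} := by
  have hxS : algebraMap (UnrSeries 3) S x ∈ Ideal.span {algebraMap (UnrSeries 3) S L} :=
    h (Ideal.mem_map_of_mem _ hx)
  obtain ⟨s, hs⟩ := Ideal.mem_span_singleton'.mp hxS
  -- `s = y / d`, `d = 3^m`
  obtain ⟨y, d, hyd⟩ := IsLocalization.exists_mk'_eq (Submonoid.powers (3 : UnrSeries 3)) s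
  obtain ⟨m, hm⟩ := (Submonoid.mem_powers_iff _ _).mp d.2
  -- `φ(L·y) = φ x · φ d`, hence `L·y = x·d` in the domain `R₀⟦T⟧`
  have h1 : IsLocalization.mk' S (L * y) d = algebraMap (UnrSeries 3) S x := by
    rw [← IsLocalization.mul_mk'_eq_mk'_of_mul, hyd, mul_comm, hs]
  rw [IsLocalization.mk'_eq_iff_eq_mul, ← map_mul] at h1
  have h2 : L * y = x * (d : UnrSeries 3) := algebraMap_away_injective h1
  refine ⟨m, Ideal.mem_span_singleton'.mpr ⟨y, ?_⟩⟩
  rw [mul_comm y L, h2, hm, mul_comm]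

/-- **For a principal ideal the two currencies coincide**: `(∃ k, 3^k·(g) ⊆ (L)) ↔ (g)·R₀⟦T⟧[1/3] ⊆ (L)·R₀⟦T⟧[1/3]`
(one `k` serves all of `(g)` — the one that serves `g`). [folklore] -/
theorem lever_span_iff_map_away_le (g L : UnrSeries 3) :
    (∃ k : ℕ, ∀ x ∈ Ideal.span ({g} : Set (UnrSeries 3)), (3 : UnrSeries 3) ^ k * x ∈ Ideal.span {L}) ↔
      (Ideal.span ({g} : Set (UnrSeries 3))).map (algebraMap (UnrSeries 3) S) ≤
        Ideal.span {algebraMap (UnrSeries 3) S L} := by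
  refine ⟨map_away_le_of_exists_pow_mul_mem _ L, fun h ↦ ?_⟩
  obtain ⟨k, hk⟩ := exists_pow_mul_mem_of_map_away_le _ L h g (Ideal.mem_span_singleton_self g)
  refine ⟨k, fun x hx ↦ ?_⟩
  obtain ⟨a, rfl⟩ := Ideal.mem_span_singleton'.mp hx
  have : (3 : UnrSeries 3) ^ k * (a * g) = a * ((3 : UnrSeries 3) ^ k * g) := by ring
  rw [this]
  exact Ideal.mul_mem_left _ a hk

end Rational

/-- **Divisibility form for a principal ideal**: `(∃ k, 3^k·(g) ⊆ (L)) ↔ ∃ k, L ∣ 3^k·g` — «`L` divides the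
characteristic power series up to a power of `3`». [folklore] -/
theorem lever_span_iff_exists_dvd (g L : UnrSeries 3) :
    (∃ k : ℕ, ∀ x ∈ Ideal.span ({g} : Set (UnrSeries 3)), (3 : UnrSeries 3) ^ k * x ∈ Ideal.span {L}) ↔
      ∃ k : ℕ, L ∣ (3 : UnrSeries 3) ^ k * g := by
  constructor
  · rintro ⟨k, hk⟩
    exact ⟨k, Ideal.mem_span_singleton.mp (hk g (Ideal.mem_span_singleton_self g))⟩
  · rintro ⟨k, hk⟩
    refine ⟨k, fun x hx ↦ ?_⟩
    obtain ⟨a, rfl⟩ := Ideal.mem_span_singleton'.mp hx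
    have : (3 : UnrSeries 3) ^ k * (a * g) = a * ((3 : UnrSeries 3) ^ k * g) := by ring
    rw [this]
    exact Ideal.mul_mem_left _ a (Ideal.mem_span_singleton.mpr hk)

/-- **The crux's ideal is principal.** `Ch_Λ(X_ac^Σ)·R₀⟦T⟧ = (g)` for some `g ∈ R₀⟦T⟧`: the characteristic ideal of
ANY `Λ`-module is principal (`Λ = ℤ_p⟦T⟧` is a UFD, Literature `charIdeal_isPrincipal_holds`), and the extension
along `Λ → R₀⟦T⟧` of a principal ideal is principal (`Ideal.map_span`); `g` is the image of a generator of
`Ch_Λ`. Valid for every `(E, p, κ, 𝔮, Σ, γ)` — no torsion hypothesis (the junk value of `Ch_Λ` is principal too).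
[cite: Washington1997, §13.2] -/
theorem charIdeal_map_eq_span {K : Type} [Field K] [NumberField K] (E : WeierstrassCurve K) (p : ℕ)
    [Fact p.Prime] (κ : ZpExtension K p) (𝔮 : HeightOneSpectrum (𝓞 K)) (Sg : Set (HeightOneSpectrum (𝓞 K)))
    (γ : absoluteGaloisGroup K) [Fact (κ.IsTopGenerator γ)] :
    ∃ g : UnrSeries p, (AcSelmer.XAc.charIdeal E p κ 𝔮 Sg γ).map (PowerSeries.map (Halves.toUnr p)) =
      Ideal.span {g} := by
  have hP : (AcSelmer.XAc.charIdeal E p κ 𝔮 Sg γ).IsPrincipal :=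
    charIdeal_isPrincipal_holds p (AcSelmer.XAc E p κ 𝔮 Sg γ)
  obtain ⟨f, hf⟩ := hP
  refine ⟨PowerSeries.map (Halves.toUnr p) f, ?_⟩
  rw [hf, Ideal.submodule_span_eq, Ideal.map_span, Set.image_singleton]

/-- **The registered LEVER's conclusion IS the rational Eisenstein inclusion**, at every instance: for the crux's
ideal `I = Ch_Λ(X_(∅,0))·R₀⟦T⟧` and any frame `L`,
`(∃ k, ∀ x ∈ I, 3^k·x ∈ (L)) ↔ I·R₀⟦T⟧[1/3] ⊆ (L)·R₀⟦T⟧[1/3]` (`I` principal by `charIdeal_map_eq_span`). This is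
the statement «`Ch_Λ(X) ⊆ (L_p)` in `Λ_{R₀} ⊗ ℚ_p`» of the printed Eisenstein-congruence theorems (their
currency before any `μ`-argument). [cite: Washington1997, §13.2] -/
theorem lever_conclusion_iff_rational {S : Type*} [CommRing S] [Algebra (UnrSeries 3) S]
    [IsLocalization.Away (3 : UnrSeries 3) S] {K : Type} [Field K] [NumberField K] (E : WeierstrassCurve K)
    (κ : ZpExtension K 3) (𝔮 : HeightOneSpectrum (𝓞 K)) (Sg : Set (HeightOneSpectrum (𝓞 K)))
    (γ : absoluteGaloisGroup K) [Fact (κ.IsTopGenerator γ)] (L : UnrSeries 3) :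
    (∃ k : ℕ, ∀ x ∈ (AcSelmer.XAc.charIdeal E 3 κ 𝔮 Sg γ).map (PowerSeries.map (Halves.toUnr 3)),
        (3 : UnrSeries 3) ^ k * x ∈ Ideal.span {L}) ↔
      ((AcSelmer.XAc.charIdeal E 3 κ 𝔮 Sg γ).map (PowerSeries.map (Halves.toUnr 3))).map
          (algebraMap (UnrSeries 3) S) ≤ Ideal.span {algebraMap (UnrSeries 3) S L} := by
  obtain ⟨g, hg⟩ := charIdeal_map_eq_span E 3 κ 𝔮 Sg γ
  rw [hg]
  exact lever_span_iff_map_away_le g L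

/-! ### §2 The lever ⟺ the crux, modulo Hsieh 2014 Thm. B -/

/-- **Pointwise: under `μ(L) = 0` the lever's conclusion and the crux's conclusion coincide.** If `L` has a unit
coefficient then `(∃ k, 3^k·I ⊆ (L)) ↔ I ⊆ (L)` (`stub_saturate`, p545527, one way; `k = 0` the other).
[folklore] -/
theorem lever_conclusion_iff_le_of_exists_isUnit_coeff (I : Ideal (UnrSeries 3)) (L : UnrSeries 3)
    (hL : ∃ n : ℕ, IsUnit (PowerSeries.coeff n L)) :
    (∃ k : ℕ, ∀ x ∈ I, (3 : UnrSeries 3) ^ k * x ∈ Ideal.span {L}) ↔ I ≤ Ideal.span {L} :=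
  ⟨stub_saturate I L hL, fun h ↦ ⟨0, fun x hx ↦ by simpa using h hx⟩⟩

/-- **Crux E ⟹ LEVER, unconditionally** (`k = 0` at every instance): the registered signature of
`stub_semiOrdinaryTransferUpToPPower` VERBATIM follows from the crux. [folklore] -/
theorem lever_of_crux (hE : WildSplitEisensteinInclusionAtThree) :
    ∀ (W : WeierstrassCurve ℚ) [W.IsElliptic] [W.IsGloballyMinimal] (N : ℕ) [NeZero N] (K : Type) [Field K] [NumberField K] (Dt : Literature.NumberTheory.EllipticCurves.ModularForms.ModularParametrizationData W N), Summit.BirchSwinnertonDyer.Rank1Residual.Additive.ClassO6 W 3 → W.HasSurjectiveModNGaloisRep 3 → W.analyticRank = 1 → W.conductorNorm ℤ = N → Literature.NumberTheory.EllipticCurves.IsImaginaryQuadratic K → Literature.NumberTheory.EllipticCurves.SatisfiesHeegnerHypothesis N K → ∀ (κ : Literature.NumberTheory.EllipticCurves.ZpExtension K 3), κ.IsAnticyclotomic → ∀ (γ : Field.absoluteGaloisGroup K) [Fact (κ.IsTopGenerator γ)] (𝔭 : IsDedekindDomain.HeightOneSpectrum (NumberField.RingOfIntegers K)), ((3 :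 ℕ) : NumberField.RingOfIntegers K) ∈ 𝔭.asIdeal → 𝔭.asIdeal.ramificationIdx (NumberField.RingOfIntegers ℚ) = 1 → 𝔭.asIdeal.inertiaDeg (NumberField.RingOfIntegers ℚ) = 1 → ∀ (𝔭' : IsDedekindDomain.HeightOneSpectrum (NumberField.RingOfIntegers K)), ((3 : ℕ) : NumberField.RingOfIntegers K) ∈ 𝔭'.asIdeal → 𝔭' ≠ 𝔭 → ∀ (ι' : PadicAlgCl 3 ≃+* ℂ), Summit.BirchSwinnertonDyer.BirchSwinnertonDyer.Theorems.SchneiderFree.BranchInducesPrime 3 ι' 𝔭 → ∀ (ΩK : ℂ) (Ωp : ℂ_[3]) (L : Literature.NumberTheory.EllipticCurves.UnrSeries 3), ΩK ≠ 0 → Ωp ≠ 0 → Literature.NumberTheory.EllipticCurves.IsBDPLFunction ι' 𝔭 κ γ Dt.f ΩK Ωp L → Module.IsTorsion (Literature.NumberTheory.EllipticCurves.IwasawaAlgebra 3) (Summit.BirchSwinnertonDyer.Rank1Residual.X11b.AcSelmer.XAc (W.baseChange K) 3 κ 𝔭' ∅ γ) → ∃ k : ℕ, ∀ x ∈ ((Summit.BirchSwinnertonDyer.Rank1Residual.X11b.AcSelmer.XAc.charIdeal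 (W.baseChange K) 3 κ 𝔭' ∅ γ).map (PowerSeries.map (Summit.BirchSwinnertonDyer.Rank1Residual.X11b.Halves.toUnr 3))), (3 : Literature.NumberTheory.EllipticCurves.UnrSeries 3) ^ k * x ∈ Ideal.span {L} := by
  intro W _ _ N _ K _ _ Dt hO6 hsurj hr1 hN hK hH κ hκ γ _ 𝔭 h𝔭 he hf 𝔭' h𝔭' hne ι' hι ΩK Ωp L hΩK hΩp hL htor
  exact ⟨0, fun x hx ↦ by
    simpa using hE W N K Dt hO6 hsurj hr1 hN hK hH κ hκ γ 𝔭 h𝔭 he hf 𝔭' h𝔭' hne ι' hι ΩK Ωp L hΩK hΩp hL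
      htor hx⟩

/-- **LEVER ⟺ crux E behind Hsieh 2014 Thm. B (any level, by name).** With `hB` the refereed named fact of p567302
§1 (which gives `μ(L) = 0` for every frame on the cell), the registered signature of
`stub_semiOrdinaryTransferUpToPPower` is EQUIVALENT to the crux `WildSplitEisensteinInclusionAtThree`
(⟹: the kernel identity `WildSplitEisensteinInclusionAtThree_of_lever_of_thmB`; ⟸: `lever_of_crux`). Planning
reading: the lever-child of a split «E = lever + Hsieh + glue» carries ALL of E except `μ`.
[cite: Hsieh2014, Thm. B p. 712 (Doc. Math. 19) = Thm. 2 (arXiv:1112.1580 p. 4 ll. 31–38)] -/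
theorem lever_iff_crux_of_thmB
    (hB : Hsieh2014.thmB_exists_isHsiehLFunction_coeff_norm_eq_one_unrPeriod_anyLevel) :
    (∀ (W : WeierstrassCurve ℚ) [W.IsElliptic] [W.IsGloballyMinimal] (N : ℕ) [NeZero N] (K : Type) [Field K] [NumberField K] (Dt : Literature.NumberTheory.EllipticCurves.ModularForms.ModularParametrizationData W N), Summit.BirchSwinnertonDyer.Rank1Residual.Additive.ClassO6 W 3 → W.HasSurjectiveModNGaloisRep 3 → W.analyticRank = 1 → W.conductorNorm ℤ = N → Literature.NumberTheory.EllipticCurves.IsImaginaryQuadratic K → Literature.NumberTheory.EllipticCurves.SatisfiesHeegnerHypothesis N K → ∀ (κ : Literature.NumberTheory.EllipticCurves.ZpExtension K 3), κ.IsAnticyclotomic → ∀ (γ : Field.absoluteGaloisGroup K) [Fact (κ.IsTopGenerator γ)] (𝔭 : IsDedekindDomain.HeightOneSpectrum (NumberField.RingOfIntegers K)), ((3 : ℕ) : NumberField.RingOfIntegers K) ∈ 𝔭.asIdeal → 𝔭.asIdeal.ramificationIdx (NumberField.RingOfIntegers ℚ) = 1 → 𝔭.asIdeal.inertiaDeg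 (NumberField.RingOfIntegers ℚ) = 1 → ∀ (𝔭' : IsDedekindDomain.HeightOneSpectrum (NumberField.RingOfIntegers K)), ((3 : ℕ) : NumberField.RingOfIntegers K) ∈ 𝔭'.asIdeal → 𝔭' ≠ 𝔭 → ∀ (ι' : PadicAlgCl 3 ≃+* ℂ), Summit.BirchSwinnertonDyer.BirchSwinnertonDyer.Theorems.SchneiderFree.BranchInducesPrime 3 ι' 𝔭 → ∀ (ΩK : ℂ) (Ωp : ℂ_[3]) (L : Literature.NumberTheory.EllipticCurves.UnrSeries 3), ΩK ≠ 0 → Ωp ≠ 0 → Literature.NumberTheory.EllipticCurves.IsBDPLFunction ι' 𝔭 κ γ Dt.f ΩK Ωp L → Module.IsTorsion (Literature.NumberTheory.EllipticCurves.IwasawaAlgebra 3) (Summit.BirchSwinnertonDyer.Rank1Residual.X11b.AcSelmer.XAc (W.baseChange K) 3 κ 𝔭' ∅ γ) → ∃ k : ℕ, ∀ x ∈ ((Summit.BirchSwinnertonDyer.Rank1Residual.X11b.AcSelmer.XAc.charIdeal (W.baseChange K) 3 κ 𝔭' ∅ γ).map (PowerSeries.map (Summit.BirchSwinnertonDyer.Rank1Residual.X11b.Halves.toUnr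 3))), (3 : Literature.NumberTheory.EllipticCurves.UnrSeries 3) ^ k * x ∈ Ideal.span {L}) ↔
      WildSplitEisensteinInclusionAtThree :=
  ⟨WildSplitEisensteinInclusionAtThreeMuHalfOfPrint.WildSplitEisensteinInclusionAtThree_of_lever_of_thmB hB,
    lever_of_crux⟩

/-! ### §3 The λ-dominance form of the crux -/

/-- **Pointwise λ-dominance criterion.** If the Kolyvagin-direction inclusion `(L) ⊆ I` holds, `I = (g)`, `g` has
no coefficient of norm `1` below degree `n` («`λ(g) ≥ n` or `μ(g) > 0`») and `‖L_n‖ = 1` («`μ(L) = 0`,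
`λ(L) ≤ n`»), then the Eisenstein inclusion `I ⊆ (L)` holds — indeed `I = (L)`
(`UniversalToricDescentNormProfile.eq_span_of_span_le_of_normProfile`). [cite: GreenbergVatsal2000, §1]
[cite: Washington1997, §7.1] -/
theorem crux_conclusion_of_span_le_of_normProfile {I : Ideal (UnrSeries 3)} {g L : UnrSeries 3} {n : ℕ}
    (hI : I = Ideal.span {g}) (hle : Ideal.span {L} ≤ I)
    (hg : ∀ i < n, ‖((PowerSeries.coeff i g : unrIntegers 3) : ℂ_[3])‖ < 1)
    (hL : ‖((PowerSeries.coeff n L : unrIntegers 3) : ℂ_[3])‖ = 1) :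
    I ≤ Ideal.span {L} :=
  (UniversalToricDescentNormProfile.eq_span_of_span_le_of_normProfile hI hle hg hL).le

/-- **At an instance, crux E + the Kolyvagin inclusion = the main-conjecture EQUALITY** `I = (L)`. [folklore] -/
theorem eq_span_iff_crux_and_kolyvagin (I : Ideal (UnrSeries 3)) (L : UnrSeries 3) :
    I = Ideal.span {L} ↔ I ≤ Ideal.span {L} ∧ Ideal.span {L} ≤ I :=
  le_antisymm_iff

/-- **Crux E from the KOLYVAGIN inclusion and λ-DOMINANCE (third decomposition of E).** Hypotheses:
`hKo` = the signature of route UTD's crux `AdditiveSplitIMCInclusionAtThree` (stmt-BirchSwinnertonDyer-20395)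
VERBATIM, displayed (that route's file is not imported): every frame `L` lies in `Ch_Λ(X_(∅,0))·R₀⟦T⟧`;
`hDom` = λ-dominance under the crux's own binders: a generator `g` of `Ch_Λ(X_(∅,0))·R₀⟦T⟧` with no norm-one
coefficient below some `n` and `‖L_n‖ = 1` (the shape of UTD's `InvariantsTransportModThree` conclusion,
WITHOUT its twin binders). Conclusion: the crux BY NAME, by `crux_conclusion_of_span_le_of_normProfile` at each
instance. Nothing is asserted about `hKo` or `hDom`. [cite: GreenbergVatsal2000, §1] [cite: Washington1997, §7.1] -/
theorem WildSplitEisensteinInclusionAtThree_of_kolyvaginInclusion_of_dominance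
    (hKo : ∀ (W : WeierstrassCurve ℚ) [W.IsElliptic] [W.IsGloballyMinimal] (N : ℕ) [NeZero N] (K : Type) [Field K] [NumberField K] (Dt : Literature.NumberTheory.EllipticCurves.ModularForms.ModularParametrizationData W N), Summit.BirchSwinnertonDyer.Rank1Residual.Additive.ClassO6 W 3 → W.HasSurjectiveModNGaloisRep 3 → W.analyticRank = 1 → W.conductorNorm ℤ = N → Literature.NumberTheory.EllipticCurves.IsImaginaryQuadratic K → Literature.NumberTheory.EllipticCurves.SatisfiesHeegnerHypothesis N K → ∀ (κ : Literature.NumberTheory.EllipticCurves.ZpExtension K 3), κ.IsAnticyclotomic → ∀ (γ : Field.absoluteGaloisGroup K) [Fact (κ.IsTopGenerator γ)] (𝔭 : IsDedekindDomain.HeightOneSpectrum (NumberField.RingOfIntegers K)), ((3 : ℕ) : NumberField.RingOfIntegers K) ∈ 𝔭.asIdeal → 𝔭.asIdeal.ramificationIdx (NumberField.RingOfIntegers ℚ) = 1 → 𝔭.asIdeal.inertiaDeg (NumberField.RingOfIntegers ℚ) = 1 → ∀ (𝔭' : IsDedekindDomain.HeightOneSpectrum (NumberField.RingOfIntegers K)),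 ((3 : ℕ) : NumberField.RingOfIntegers K) ∈ 𝔭'.asIdeal → 𝔭' ≠ 𝔭 → ∀ (ι' : PadicAlgCl 3 ≃+* ℂ), Summit.BirchSwinnertonDyer.BirchSwinnertonDyer.Theorems.SchneiderFree.BranchInducesPrime 3 ι' 𝔭 → ∀ (ΩK : ℂ) (Ωp : ℂ_[3]) (L : Literature.NumberTheory.EllipticCurves.UnrSeries 3), ΩK ≠ 0 → Ωp ≠ 0 → Literature.NumberTheory.EllipticCurves.IsBDPLFunction ι' 𝔭 κ γ Dt.f ΩK Ωp L → Ideal.span {L} ≤ (Summit.BirchSwinnertonDyer.Rank1Residual.X11b.AcSelmer.XAc.charIdeal (W.baseChange K) 3 κ 𝔭' ∅ γ).map (PowerSeries.map (Summit.BirchSwinnertonDyer.Rank1Residual.X11b.Halves.toUnr 3)))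
    (hDom : ∀ (W : WeierstrassCurve ℚ) [W.IsElliptic] [W.IsGloballyMinimal] (N : ℕ) [NeZero N] (K : Type) [Field K] [NumberField K] (Dt : Literature.NumberTheory.EllipticCurves.ModularForms.ModularParametrizationData W N), Summit.BirchSwinnertonDyer.Rank1Residual.Additive.ClassO6 W 3 → W.HasSurjectiveModNGaloisRep 3 → W.analyticRank = 1 → W.conductorNorm ℤ = N → Literature.NumberTheory.EllipticCurves.IsImaginaryQuadratic K → Literature.NumberTheory.EllipticCurves.SatisfiesHeegnerHypothesis N K → ∀ (κ : Literature.NumberTheory.EllipticCurves.ZpExtension K 3), κ.IsAnticyclotomic → ∀ (γ : Field.absoluteGaloisGroup K) [Fact (κ.IsTopGenerator γ)] (𝔭 : IsDedekindDomain.HeightOneSpectrum (NumberField.RingOfIntegers K)), ((3 : ℕ) : NumberField.RingOfIntegers K) ∈ 𝔭.asIdeal → 𝔭.asIdeal.ramificationIdx (NumberField.RingOfIntegers ℚ) = 1 → 𝔭.asIdeal.inertiaDeg (NumberField.RingOfIntegers ℚ) = 1 → ∀ (𝔭' : IsDedekindDomain.HeightOneSpectrum (NumberField.RingOfIntegers K)),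 ((3 : ℕ) : NumberField.RingOfIntegers K) ∈ 𝔭'.asIdeal → 𝔭' ≠ 𝔭 → ∀ (ι' : PadicAlgCl 3 ≃+* ℂ), Summit.BirchSwinnertonDyer.BirchSwinnertonDyer.Theorems.SchneiderFree.BranchInducesPrime 3 ι' 𝔭 → ∀ (ΩK : ℂ) (Ωp : ℂ_[3]) (L : Literature.NumberTheory.EllipticCurves.UnrSeries 3), ΩK ≠ 0 → Ωp ≠ 0 → Literature.NumberTheory.EllipticCurves.IsBDPLFunction ι' 𝔭 κ γ Dt.f ΩK Ωp L → Module.IsTorsion (Literature.NumberTheory.EllipticCurves.IwasawaAlgebra 3) (Summit.BirchSwinnertonDyer.Rank1Residual.X11b.AcSelmer.XAc (W.baseChange K) 3 κ 𝔭' ∅ γ) → ∃ (g : Literature.NumberTheory.EllipticCurves.UnrSeries 3) (n : ℕ), (Summit.BirchSwinnertonDyer.Rank1Residual.X11b.AcSelmer.XAc.charIdeal (W.baseChange K) 3 κ 𝔭' ∅ γ).map (PowerSeries.map (Summit.BirchSwinnertonDyer.Rank1Residual.X11b.Halves.toUnr 3)) = Ideal.span {g} ∧ (∀ i < n, ‖((PowerSeries.coeff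 i g : Literature.NumberTheory.EllipticCurves.unrIntegers 3) : ℂ_[3])‖ < 1) ∧ ‖((PowerSeries.coeff n L : Literature.NumberTheory.EllipticCurves.unrIntegers 3) : ℂ_[3])‖ = 1) :
    WildSplitEisensteinInclusionAtThree := by
  intro W _ _ N _ K _ _ Dt hO6 hsurj hr1 hN hK hH κ hκ γ _ 𝔭 h𝔭 he hf 𝔭' h𝔭' hne ι' hι ΩK Ωp L hΩK hΩp hL htor
  obtain ⟨g, n, hg, hgn, hLn⟩ :=
    hDom W N K Dt hO6 hsurj hr1 hN hK hH κ hκ γ 𝔭 h𝔭 he hf 𝔭' h𝔭' hne ι' hι ΩK Ωp L hΩK hΩp hL htor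
  exact crux_conclusion_of_span_le_of_normProfile hg
    (hKo W N K Dt hO6 hsurj hr1 hN hK hH κ hκ γ 𝔭 h𝔭 he hf 𝔭' h𝔭' hne ι' hι ΩK Ωp L hΩK hΩp hL) hgn hLn

/-- **Crux E + the Kolyvagin inclusion = the `(∅,0)` main-conjecture EQUALITY on the cell.** From the crux BY NAME
and the signature of UTD's `AdditiveSplitIMCInclusionAtThree` (stmt-BirchSwinnertonDyer-20395) displayed as a
hypothesis: for every instance of the crux's binders (torsion guard included), `Ch_Λ(X_(∅,0))·R₀⟦T⟧ = (L)` — the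
conclusion shape of UTD's `ToricTransportModThree` (20186) WITHOUT twin binders. Pure bookkeeping
(`le_antisymm`); nothing asserted about either hypothesis. [folklore] -/
theorem imcEquality_of_crux_of_kolyvaginInclusion (hE : WildSplitEisensteinInclusionAtThree)
    (hKo : ∀ (W : WeierstrassCurve ℚ) [W.IsElliptic] [W.IsGloballyMinimal] (N : ℕ) [NeZero N] (K : Type) [Field K] [NumberField K] (Dt : Literature.NumberTheory.EllipticCurves.ModularForms.ModularParametrizationData W N), Summit.BirchSwinnertonDyer.Rank1Residual.Additive.ClassO6 W 3 → W.HasSurjectiveModNGaloisRep 3 → W.analyticRank = 1 → W.conductorNorm ℤ = N → Literature.NumberTheory.EllipticCurves.IsImaginaryQuadratic K → Literature.NumberTheory.EllipticCurves.SatisfiesHeegnerHypothesis N K → ∀ (κ : Literature.NumberTheory.EllipticCurves.ZpExtension K 3), κ.IsAnticyclotomic → ∀ (γ : Field.absoluteGaloisGroup K) [Fact (κ.IsTopGenerator γ)] (𝔭 : IsDedekindDomain.HeightOneSpectrum (NumberField.RingOfIntegers K)), ((3 : ℕ) : NumberField.RingOfIntegers K) ∈ 𝔭.asIdeal → 𝔭.asIdeal.ramificationIdx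 (NumberField.RingOfIntegers ℚ) = 1 → 𝔭.asIdeal.inertiaDeg (NumberField.RingOfIntegers ℚ) = 1 → ∀ (𝔭' : IsDedekindDomain.HeightOneSpectrum (NumberField.RingOfIntegers K)), ((3 : ℕ) : NumberField.RingOfIntegers K) ∈ 𝔭'.asIdeal → 𝔭' ≠ 𝔭 → ∀ (ι' : PadicAlgCl 3 ≃+* ℂ), Summit.BirchSwinnertonDyer.BirchSwinnertonDyer.Theorems.SchneiderFree.BranchInducesPrime 3 ι' 𝔭 → ∀ (ΩK : ℂ) (Ωp : ℂ_[3]) (L : Literature.NumberTheory.EllipticCurves.UnrSeries 3), ΩK ≠ 0 → Ωp ≠ 0 → Literature.NumberTheory.EllipticCurves.IsBDPLFunction ι' 𝔭 κ γ Dt.f ΩK Ωp L → Ideal.span {L} ≤ (Summit.BirchSwinnertonDyer.Rank1Residual.X11b.AcSelmer.XAc.charIdeal (W.baseChange K) 3 κ 𝔭' ∅ γ).map (PowerSeries.map (Summit.BirchSwinnertonDyer.Rank1Residual.X11b.Halves.toUnr 3))) :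
    ∀ (W : WeierstrassCurve ℚ) [W.IsElliptic] [W.IsGloballyMinimal] (N : ℕ) [NeZero N] (K : Type) [Field K] [NumberField K] (Dt : Literature.NumberTheory.EllipticCurves.ModularForms.ModularParametrizationData W N), Summit.BirchSwinnertonDyer.Rank1Residual.Additive.ClassO6 W 3 → W.HasSurjectiveModNGaloisRep 3 → W.analyticRank = 1 → W.conductorNorm ℤ = N → Literature.NumberTheory.EllipticCurves.IsImaginaryQuadratic K → Literature.NumberTheory.EllipticCurves.SatisfiesHeegnerHypothesis N K → ∀ (κ : Literature.NumberTheory.EllipticCurves.ZpExtension K 3), κ.IsAnticyclotomic → ∀ (γ : Field.absoluteGaloisGroup K) [Fact (κ.IsTopGenerator γ)] (𝔭 : IsDedekindDomain.HeightOneSpectrum (NumberField.RingOfIntegers K)), ((3 : ℕ) : NumberField.RingOfIntegers K) ∈ 𝔭.asIdeal → 𝔭.asIdeal.ramificationIdx (NumberField.RingOfIntegers ℚ) = 1 → 𝔭.asIdeal.inertiaDeg (NumberField.RingOfIntegers ℚ) = 1 → ∀ (𝔭' : IsDedekindDomain.HeightOneSpectrum (NumberField.RingOfIntegers K)), ((3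 : ℕ) : NumberField.RingOfIntegers K) ∈ 𝔭'.asIdeal → 𝔭' ≠ 𝔭 → ∀ (ι' : PadicAlgCl 3 ≃+* ℂ), Summit.BirchSwinnertonDyer.BirchSwinnertonDyer.Theorems.SchneiderFree.BranchInducesPrime 3 ι' 𝔭 → ∀ (ΩK : ℂ) (Ωp : ℂ_[3]) (L : Literature.NumberTheory.EllipticCurves.UnrSeries 3), ΩK ≠ 0 → Ωp ≠ 0 → Literature.NumberTheory.EllipticCurves.IsBDPLFunction ι' 𝔭 κ γ Dt.f ΩK Ωp L → Module.IsTorsion (Literature.NumberTheory.EllipticCurves.IwasawaAlgebra 3) (Summit.BirchSwinnertonDyer.Rank1Residual.X11b.AcSelmer.XAc (W.baseChange K) 3 κ 𝔭' ∅ γ) → (Summit.BirchSwinnertonDyer.Rank1Residual.X11b.AcSelmer.XAc.charIdeal (W.baseChange K) 3 κ 𝔭' ∅ γ).map (PowerSeries.map (Summit.BirchSwinnertonDyer.Rank1Residual.X11b.Halves.toUnr 3)) = Ideal.span {L} := by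
  intro W _ _ N _ K _ _ Dt hO6 hsurj hr1 hN hK hH κ hκ γ _ 𝔭 h𝔭 he hf 𝔭' h𝔭' hne ι' hι ΩK Ωp L hΩK hΩp hL htor
  exact le_antisymm
    (hE W N K Dt hO6 hsurj hr1 hN hK hH κ hκ γ 𝔭 h𝔭 he hf 𝔭' h𝔭' hne ι' hι ΩK Ωp L hΩK hΩp hL htor)
    (hKo W N K Dt hO6 hsurj hr1 hN hK hH κ hκ γ 𝔭 h𝔭 he hf 𝔭' h𝔭' hne ι' hι ΩK Ωp L hΩK hΩp hL)

/-! ### §4 The finite-Selmer corner: there crux E says exactly «`L` is a unit» (appended, w2 g0)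

Where the Selmer dual `X_(∅,0)` is FINITE (pseudo-null: `λ_alg = μ_alg = 0`; in particular where it is zero) its
characteristic ideal is `Λ` (Literature `isPseudoNull_of_finite`, `Module.charIdeal_eq_top_of_isPseudoNull`), so
the crux's ideal is all of `R₀⟦T⟧`: the Kolyvagin inclusion (UTD 20395's conclusion) is EMPTY there and crux E's
conclusion is EXACTLY `L ∈ R₀⟦T⟧ˣ`, i.e. `‖L(𝟙)‖ = 1` — the crux pins the `3`-adic valuation of the BDP/LZZ value
at the trivial character to `0` on every instance with finite `Sel_(∅,0)(K_∞, E[3^∞])^∨`; the lever there reads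
`L ∣ 3^k` («`λ(L) = 0`»). -/

section FiniteCorner

variable {K : Type} [Field K] [NumberField K] (E : WeierstrassCurve K) (κ : ZpExtension K 3)
  (𝔮 : HeightOneSpectrum (𝓞 K)) (Sg : Set (HeightOneSpectrum (𝓞 K))) (γ : absoluteGaloisGroup K)
  [Fact (κ.IsTopGenerator γ)]

/-- **Finite `X` ⟹ the crux's ideal is everything.** If `X_ac^Σ` is finite then
`Ch_Λ(X_ac^Σ)·R₀⟦T⟧ = R₀⟦T⟧`. [cite: BourbakiAC5to7, Ch. VII §4 no. 5] -/
theorem charIdeal_map_eq_top_of_finite [Finite (AcSelmer.XAc E 3 κ 𝔮 Sg γ)] :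
    (AcSelmer.XAc.charIdeal E 3 κ 𝔮 Sg γ).map (PowerSeries.map (Halves.toUnr 3)) = ⊤ := by
  have h : AcSelmer.XAc.charIdeal E 3 κ 𝔮 Sg γ = ⊤ := by
    unfold AcSelmer.XAc.charIdeal
    exact Literature.NumberTheory.EllipticCurves.Module.charIdeal_eq_top_of_isPseudoNull
      (Literature.NumberTheory.EllipticCurves.isPseudoNull_of_finite 3 (AcSelmer.XAc E 3 κ 𝔮 Sg γ))
  rw [h, Ideal.map_top]

/-- **In the finite-Selmer corner crux E's conclusion is «`L` is a unit of `R₀⟦T⟧`».** [folklore] -/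
theorem crux_conclusion_iff_isUnit_of_finite [Finite (AcSelmer.XAc E 3 κ 𝔮 Sg γ)] (L : UnrSeries 3) :
    (AcSelmer.XAc.charIdeal E 3 κ 𝔮 Sg γ).map (PowerSeries.map (Halves.toUnr 3)) ≤ Ideal.span {L} ↔
      IsUnit L := by
  rw [charIdeal_map_eq_top_of_finite, top_le_iff, Ideal.span_singleton_eq_top]

/-- **In the finite-Selmer corner the Kolyvagin inclusion is empty** (`(L) ⊆ R₀⟦T⟧` always). [folklore] -/
theorem kolyvagin_conclusion_of_finite [Finite (AcSelmer.XAc E 3 κ 𝔮 Sg γ)] (L : UnrSeries 3) :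
    Ideal.span {L} ≤ (AcSelmer.XAc.charIdeal E 3 κ 𝔮 Sg γ).map (PowerSeries.map (Halves.toUnr 3)) := by
  rw [charIdeal_map_eq_top_of_finite]
  exact le_top

/-- **In the finite-Selmer corner the LEVER's conclusion is «`L ∣ 3^k` for some `k`»** (`λ(L) = 0`, `μ(L)` free).
[folklore] -/
theorem lever_conclusion_iff_dvd_pow_of_finite [Finite (AcSelmer.XAc E 3 κ 𝔮 Sg γ)] (L : UnrSeries 3) :
    (∃ k : ℕ, ∀ x ∈ (AcSelmer.XAc.charIdeal E 3 κ 𝔮 Sg γ).map (PowerSeries.map (Halves.toUnr 3)),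
        (3 : UnrSeries 3) ^ k * x ∈ Ideal.span {L}) ↔ ∃ k : ℕ, L ∣ (3 : UnrSeries 3) ^ k := by
  rw [charIdeal_map_eq_top_of_finite]
  constructor
  · rintro ⟨k, hk⟩
    exact ⟨k, Ideal.mem_span_singleton.mp (by simpa using hk 1 Submodule.mem_top)⟩
  · rintro ⟨k, hk⟩
    exact ⟨k, fun x _ ↦ Ideal.mem_span_singleton.mpr (hk.mul_right x)⟩

end FiniteCorner

/-- **Unit ⟺ the value at the trivial character has norm one**: `L ∈ R₀⟦T⟧ˣ ↔ ‖L(𝟙)‖ = 1` in `ℂ₃`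
(`L(𝟙) = L(T = 0)` = the constant term; Mathlib `PowerSeries.isUnit_iff_constantCoeff` and
`unrIntegers.isUnit_iff_norm_eq_one`). With `crux_conclusion_iff_isUnit_of_finite`: on every instance with finite
`X_(∅,0)`, crux E is the numerical statement `‖L(𝟙)‖₃ = 1` about the frame's value at the trivial character.
[folklore] -/
theorem isUnit_iff_norm_constantCoeff_eq_one (L : UnrSeries 3) :
    IsUnit L ↔ ‖((PowerSeries.constantCoeff L : unrIntegers 3) : ℂ_[3])‖ = 1 := by
  rw [PowerSeries.isUnit_iff_constantCoeff, unrIntegers.isUnit_iff_norm_eq_one]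

end Summit.BirchSwinnertonDyer.BirchSwinnertonDyer.Theorems.WildSplitEisensteinInclusionAtThreeLeverCurrency

end
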